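import Mathlib
import Literature.Analysis.FluidPDE.VectorCalculus
import Literature.Analysis.FluidPDE.ClassicalSolution
import Literature.Analysis.FluidPDE.AxisymmetricEuler
import Literature.Analysis.FluidPDE.SverakLandauClassification
import Summits.NavierStokesRegularity.NavierStokesRegularity.Theorems.ThreadingFluxCentreJetDefs
import HarnessLib

/-!
# Crux `PoloidalLiouville` (stmt-NavierStokesRegularity-1222, wall W1), crux idea «azimuthal-cartan-test» (ns-idea-15 g10, lens
# «negation»; critic V26 PASS-WITH-PRICE, paid): DEFINITIONS TWIN of `Cruxes/PoloidalLiouville/AzimuthalCartanSketch.lean` v1.3c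

Theorems-side twin (definitions only; experiment cell `ns-wall-extremal`, width hand ns-wall-eng-6 g4; 0 kit) of the OBJECTS and TYPED
STATEMENTS of the sketch `AzimuthalCartanSketch.lean` (v1.3c, tree sha16 e7283c057928645f, 478 l.), so that kernel proofs of its rungs —
first R♯ `ShellReduction` (`ThreadingFluxAzimuthalCartanShellReduction.lean`, this seat) and the keyed items of ns-wall-eng-8 (L
`LandauBaseFacts`, V♯ `LandauVertexFlexibility`) and whoever is keyed on J♭ / K♭ — can be stated over importable names and the sketch's
Props close BY NAME (`Iff.rfl` guards + `_holds` one-liners, the device of `ThreadingFluxCentreJetDefs.lean` /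
`ThreadingFluxErtelTowerDefs.lean`).  Bodies are VERBATIM copies of the sketch (generated by copying the tree file and deleting only the
module docstring, the `Theses.ThreadingFlux` import and the glue theorems), in the namespace
`Summit.NavierStokesRegularity.NavierStokesRegularity.Theorems.PoloidalLiouville.AzimuthalCartan` (objects `E3`, `IsUnthreadedAbout`,
`IsSteadyNSOn` by name from `ThreadingFluxCentreJetDefs.lean`, as in the sketch).

Objects and predicates: `IsUnthreadedOn`, `IsMinusOneHomogeneousOn`, `IsSkewAxis`, `IsEquivariantOn`, `HasConstantSwirlOn`,
`LinearisedSteadyNSOn`, `tilt`, `shell`, `landau2`, `landauPressure2`, `J3`, `xTest`, `e3`, `axialCoords`, `solidTorus`, `landauTorus`,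
`poiseuille`, `poiseuillePressure`, `cylRadius`, `azimuth`, `jordanMode`, `crossFlowAxial`, `crossFlow`, `crossFlowPressure`,
`IsAxisymmetricBaseOn`, `InfinitesimallyRigidOn`.
Typed statements (Props, none proved here; statuses — CONJECTURE / FALSE / PROVABLE / OPEN reduction — exactly as labelled in the
sketch's docstrings, which are copied verbatim below, and in the card `Cruxes/PoloidalLiouville/Ideas/azimuthal-cartan-test.md`):
`InfinitesimalRigidityOffCentre`, `InfinitesimalRigidityOffCentreBall`, `PoiseuilleJordanMode`, `PoiseuilleBaseFacts`,
`LandauBallJordanMode`, `LandauVertexFlexibility`, `LandauBaseFacts`, `SteadyLocalRigidityOffCentre`,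
`SteadyLocalRigidityOffCentreUnrestricted`, `PoloidalConicalFlows`, `SectorialCrossFlows`, `SectorialCrossFlowOne`,
`SteadyShellRigidity`, `SteadyUnthreadedLiouville'`, `ShellReduction`.
NOT twinned (they live in the sketch): the pure-logic glue theorems `ballRigidity_refuted`, `ballRigidity_refuted_landau`,
`landau_vertex_is_degenerate`, `conicalFlows_refute_unrestricted`, `offCentre_of_unrestricted`, `sectorialCrossFlowOne_of`,
`crossFlowOne_refutes_ballRigidity`, `crossFlows_refute_ballRigidity`, `crossFlows_refute_unrestricted`, `steadyStratum_of_shell`.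

HONEST FRAME (critic V26 P1–P5 words stand): LOCAL / semi-local, STEADY, analytic-category statements strictly below W1, explicit
witnesses, and one reduction to the steady stratum; typing a Prop here asserts nothing.  `PoloidalLiouville` (1222), its steady stratum
`SteadyUnthreadedLiouville'`, `stub_scalarLiouville`, `UnthreadedRigidity` (27585) and NS regularity are OPEN and untouched.  Author of
the statements: planner ns-idea-15 g10; filed Theorems-side by ns-wall-eng-6 g4.

## References
* V. Šverák, On Landau's solutions of the Navier–Stokes equations, J. Math. Sci. 179 (2011) 208–228, arXiv:math/0604550. [Sverak2011]
* L. Li, Y. Y. Li, X. Yan, Homogeneous solutions of stationary Navier–Stokes equations with isolated singularities on the unit sphere,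
arXiv:1609.08197, arXiv:1704.08730.
* V. Shtern, F. Hussain, Azimuthal instability of divergent flows, J. Fluid Mech. 256 (1993) 535–560, doi:10.1017/s0022112093002873.
* S. Weinbaum, V. O'Brien, Exact Navier–Stokes solutions including swirl and cross flow, Phys. Fluids 10 (1967) 1438,
doi:10.1063/1.1762303.
* R. Bryant, S.-S. Chern, R. Gardner, H. Goldschmidt, P. Griffiths, *Exterior Differential Systems* (Springer 1991), ch. IX–X.
-/

-- the summit and its single problem share the name (D-0017 nested layout)
set_option linter.dupNamespace false

noncomputable section

namespace Summit.NavierStokesRegularity.NavierStokesRegularity.Theorems.PoloidalLiouville.AzimuthalCartan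

open Set Function Metric
open Literature.Analysis.FluidPDE (cross curl crossCLM swirl landauAxisField landauAxisPressure Sverak2011_landauClassification)
open Summit.NavierStokesRegularity.NavierStokesRegularity.Theorems.PoloidalLiouville.CentreJet
  (E3 IsUnthreadedAbout IsSteadyNSOn)

/-! ## Objects -/

/-- `W` is unthreaded about `x₀` ON `U`: `⟪x − x₀, curl W x⟫ = 0` for `x ∈ U` (1222's hypothesis, localised; linear in `W`, so it is
also the linearised constraint). -/
def IsUnthreadedOn (U : Set E3) (x₀ : E3) (W : E3 → E3) : Prop :=
  ∀ x ∈ U, inner ℝ (x - x₀) (curl W x) = 0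

/-- `V` is homogeneous of degree `−1` about `x₀` on `U` (Euler identity `DV(x)(x − x₀) = −V(x)`; for analytic `V` on a connected `U`
this is homogeneity on the cone through `U`).  The DEGENERACY excluded by I♭/C♭ and realised by the Landau flow about its vertex. -/
def IsMinusOneHomogeneousOn (U : Set E3) (x₀ : E3) (V : E3 → E3) : Prop :=
  ∀ x ∈ U, fderiv ℝ V x (x - x₀) = -(V x)

/-- A non-zero skew endomorphism of `ℝ³` = an infinitesimal rotation `A y = a × y` about the axis `ℝa` (`a ≠ 0`); same shape as the
conclusion of `UnthreadedRigidityDoor.UnthreadedRigidity` (stmt-27585). -/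
def IsSkewAxis (A : E3 →L[ℝ] E3) : Prop :=
  (∀ x : E3, inner ℝ (A x) x = 0) ∧ A ≠ 0

/-- Infinitesimal rotational equivariance of `W` on `U` about the axis of `A` through `x₀`: the Lie derivative of `W` along the
rotation field `x ↦ A (x − x₀)` vanishes, `DW(x)(A(x − x₀)) = A (W x)` (27585's conclusion, localised to `U`). -/
def IsEquivariantOn (U : Set E3) (x₀ : E3) (A : E3 →L[ℝ] E3) (W : E3 → E3) : Prop :=
  ∀ x ∈ U, fderiv ℝ W x (A (x - x₀)) = A (W x)

/-- The swirl of `W` about the axis of `A` through `x₀`, `⟪W x, A (x − x₀)⟫ = ρ W_φ`, is CONSTANT on `U` (value `κ`: the potential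
vortex `κ/ρ e_φ`, the only swirl the unthreaded constraint allows at mode `k = 0`; `κ = 0` = no swirl). -/
def HasConstantSwirlOn (U : Set E3) (x₀ : E3) (A : E3 →L[ℝ] E3) (W : E3 → E3) : Prop :=
  ∃ κ : ℝ, ∀ x ∈ U, inner ℝ (W x) (A (x - x₀)) = κ

/-- Linearised steady Navier–Stokes at the base `V` on `U` (`ν = 1`): `div δv = 0`, `(V·∇)δv + (δv·∇)V + ∇δp = Δ δv`. -/
def LinearisedSteadyNSOn (U : Set E3) (V δv : E3 → E3) (δp : E3 → ℝ) : Prop :=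
  (∀ x ∈ U, Literature.Analysis.FluidPDE.VectorCalculus.divergence δv x = 0) ∧
    ∀ x ∈ U, fderiv ℝ δv x (V x) + fderiv ℝ V x (δv x) + gradient δp x = Laplacian.laplacian δv x

/-- The infinitesimal TILT of `V` about `x₀` with angular velocity `Ω`: `d/dθ|₀` of `R_θ V (R_θ⁻¹ ·)` (rotations about the axis `ℝΩ`
through `x₀`), `tilt V x₀ Ω x = Ω × V x − DV(x)(Ω × (x − x₀))`.  For an axisymmetric base and `Ω ⊥` axis this is the unique `k = 1`
solution found by the count (verified exactly in the engine). -/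
def tilt (V : E3 → E3) (x₀ Ω : E3) : E3 → E3 :=
  fun x => cross Ω (V x) - fderiv ℝ V x (cross Ω (x - x₀))

/-- The open spherical shell `r₁ < |x − x₀| < r₂` (rotation-invariant about every axis through `x₀`; avoids the centre). -/
def shell (x₀ : E3) (r₁ r₂ : ℝ) : Set E3 :=
  {x | r₁ < dist x x₀ ∧ dist x x₀ < r₂}

/-- The Landau solution with parameter `2`, axis `e₂`, vertex `0` — BY NAME the tree's `Literature.Analysis.FluidPDE.landauAxisField`
(Šverák 2011 (4.7); spherical: `v_r = (2/r)((c²−1)/(c − cos θ)² − 1)`, `v_θ = −2 sin θ/(r (c − cos θ))`, no swirl); the engine's `landau` base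
with `A = 2` is this field (same Cartesian formula, checked by hand against `landauAxisField`). -/
abbrev landau2 : E3 → E3 := landauAxisField (EuclideanSpace.single 2 1) 2

/-- Its pressure, BY NAME `Literature.Analysis.FluidPDE.landauAxisPressure` (`p = 4 (c cos θ − 1)/(r² (c − cos θ)²)`; the sign the engine uses). -/
abbrev landauPressure2 : E3 → ℝ := landauAxisPressure (EuclideanSpace.single 2 1) 2

/-- The rotation generator about the `e₂`-axis, `J₃ y = e₂ × y`. -/
def J3 : E3 →L[ℝ] E3 := crossCLM (EuclideanSpace.single 2 1)

/-- The regular test point `x₁ = (3, 0, 4)` (`|x₁| = 5`, cylindrical radius 3): the point of the computation. -/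
def xTest : E3 := EuclideanSpace.single 0 3 + EuclideanSpace.single 2 4

/-- `e₃ = (0,0,1)`: used both as the AXIS VECTOR of the Landau base and as the off-vertex CENTRE `x₀ = (0,0,1)` on that axis. -/
def e3 : E3 := EuclideanSpace.single 2 1

/-- (v1.2) Axial coordinates of `x` about the line `x₀ + ℝa`: (distance to the line, signed height along `a/‖a‖`). -/
def axialCoords (x₀ a x : E3) : ℝ × ℝ :=
  (Real.sqrt (‖x - x₀‖ ^ 2 - (inner ℝ (x - x₀) a) ^ 2 / ‖a‖ ^ 2), inner ℝ (x - x₀) a / ‖a‖)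

/-- (v1.2) The open SOLID TORUS about the line `x₀ + ℝa` whose meridional section is the (sup-metric) disc of radius `ε` about
`c = (ρ₁, z₁)`; used with `ε < ρ₁`, so it misses the axis.  ROTATION-INVARIANT about the axis by construction: an analytic field on it is
`2π`-periodic in the azimuth, which is what makes the per-integer-mode count the whole story (critic V26 P1). -/
def solidTorus (x₀ a : E3) (c : ℝ × ℝ) (ε : ℝ) : Set E3 :=
  {x | dist (axialCoords x₀ a x) c < ε}

/-- The solid torus of the computation at the Landau base: axis `e₃` through the vertex `0`, section disc of radius `1` about
`(ρ₁, z₁) = (3, 4)` (it contains `xTest` and misses the axis and the vertex). -/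
def landauTorus : Set E3 := solidTorus 0 e3 (3, 4) 1

/-- (v1.3) The Hagen–Poiseuille base `V = −ρ² e₃` (`ρ² = x² + y²`), pressure `−4z` (`ν = 1`): analytic on `ℝ³`, steady NS,
axisymmetric about `e₃` with no swirl, `curl V = (−2y, 2x, 0)`. -/
def poiseuille : E3 → E3 := fun x => EuclideanSpace.single 2 (-(x 0 ^ 2 + x 1 ^ 2))

/-- Its pressure `p = −4z`. -/
def poiseuillePressure : E3 → ℝ := fun x => -4 * x 2

/-- Cylindrical radius `ρ = √(x² + y²)` about the `e₃`-axis. -/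
def cylRadius (x : E3) : ℝ := Real.sqrt (x 0 ^ 2 + x 1 ^ 2)

/-- The azimuth `φ = arctan (y/x)` — a genuine analytic coordinate on the half-space `x > 0`, which contains `ball xTest 1`. -/
def azimuth (x : E3) : ℝ := Real.arctan (x 1 / x 0)

/-- (v1.3, J♭'s explicit witness) the `φ`-LINEAR MODE at the Poiseuille base:
`δv = (φ/ρ) e_φ − (log ρ/ρ) e_ρ + (ρ²/2)(log ρ − 1) e₃ = ∇((φ² − log²ρ)/2) + (ρ²/2)(log ρ − 1) e₃` (with `δp = 0`). -/
def jordanMode : E3 → E3 := fun x =>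
  EuclideanSpace.single 0 ((-(azimuth x) * x 1 - Real.log (cylRadius x) * x 0) / cylRadius x ^ 2) +
  EuclideanSpace.single 1 ((azimuth x * x 0 - Real.log (cylRadius x) * x 1) / cylRadius x ^ 2) +
  EuclideanSpace.single 2 (cylRadius x ^ 2 / 2 * (Real.log (cylRadius x) - 1))

/-- (v1.3, K♭'s axial profile) `G_γ(ρ) = ∫₂^ρ s⁻¹ e^{−γ (log s)²} ds`, the solution of `G″ + (1 + 2γ log ρ) G′/ρ = 0` with `G′(ρ) = ρ⁻¹e^{−γ log²ρ}`
(a Gaussian integral in `log ρ`; analytic on `ρ > 0`). -/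
def crossFlowAxial (γ r : ℝ) : ℝ := ∫ s in (2 : ℝ)..r, Real.exp (-(γ * Real.log s ^ 2)) / s

/-- (v1.3, K♭'s explicit family) the SECTORIAL CROSS FLOW `u_γ = ∇Χ_γ + G_γ(ρ) e₃`, `Χ_γ = γ(φ² − (log ρ)²)`:
`u_γ = (2γ/ρ²)(φ·(−y, x, 0) − log ρ·(x, y, 0)) + G_γ(ρ) e₃`. -/
def crossFlow (γ : ℝ) : E3 → E3 := fun x =>
  EuclideanSpace.single 0 (2 * γ * (-(azimuth x) * x 1 - Real.log (cylRadius x) * x 0) / cylRadius x ^ 2) +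
  EuclideanSpace.single 1 (2 * γ * (azimuth x * x 0 - Real.log (cylRadius x) * x 1) / cylRadius x ^ 2) +
  EuclideanSpace.single 2 (crossFlowAxial γ (cylRadius x))

/-- Its pressure `p = −|u_γ|²/2 + G_γ(ρ)²/2` (the constant `c` of the class taken `0`). -/
def crossFlowPressure (γ : ℝ) : E3 → ℝ := fun x =>
  -(‖crossFlow γ x‖ ^ 2) / 2 + crossFlowAxial γ (cylRadius x) ^ 2 / 2

/-- An ADMISSIBLE AXISYMMETRIC BASE on `U`: `V, p` analytic, steady NS on `U`, `A` a rotation generator, `V` infinitesimally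
`A`-equivariant about `x₀` with NO swirl, and `curl V ≢ 0` on `U` (potential flows excluded). -/
def IsAxisymmetricBaseOn (U : Set E3) (x₀ : E3) (A : E3 →L[ℝ] E3) (V : E3 → E3) (p : E3 → ℝ) : Prop :=
  AnalyticOnNhd ℝ V U ∧ AnalyticOnNhd ℝ p U ∧ IsSteadyNSOn U V p ∧ IsSkewAxis A ∧ IsEquivariantOn U x₀ A V ∧
    (∀ x ∈ U, inner ℝ (V x) (A (x - x₀)) = 0) ∧ ∃ x ∈ U, curl V x ≠ 0

/-- INFINITESIMAL RIGIDITY of the base `V` on `U` about `(x₀, A)`: every analytic solution of the linearised steady NS system on `U`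
that is unthreaded about `x₀` is a tilt of `V` about `x₀` plus an `A`-equivariant field. -/
def InfinitesimallyRigidOn (U : Set E3) (x₀ : E3) (A : E3 →L[ℝ] E3) (V : E3 → E3) : Prop :=
  ∀ (δv : E3 → E3) (δp : E3 → ℝ), AnalyticOnNhd ℝ δv U → AnalyticOnNhd ℝ δp U →
    LinearisedSteadyNSOn U V δv δp → IsUnthreadedOn U x₀ δv → ∃ Ω : E3, IsEquivariantOn U x₀ A (δv - tilt V x₀ Ω)

/-! ## Statements -/

/-- (I♭, conjecture C — COMPUTED EVIDENCE, the card's first lemma; v1.2: RE-TYPED ON SOLID TORI, critic V26 P1) **Infinitesimal rigidity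
off the centre.**  Let `V, p` be an admissible axisymmetric base (analytic steady NS, equivariant with no swirl about the axis `x₀ + ℝa`,
`curl V ≢ 0`) on the rotation-invariant solid torus `T = solidTorus x₀ a c ε` (`ε < c.1`: off the axis), NOT (−1)-homogeneous about `x₀`
on `T`.  Then every analytic solution `(δv, δp)` on `T` of the linearised steady NS system at `V` which is unthreaded about `x₀` is a TILT
plus an equivariant field.  Why a torus: on `T` an analytic `δv` is `2π`-periodic in the azimuth, so it is the sum of its INTEGER Fourier
modes, each with meridional coefficients analytic near `c`; per mode `k ∉ {0, ±1}` the formal solution space at `c` is `0` (computed), so the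
mode vanishes identically — no convergence issue (P2); `k = ±1` carries only the tilt jet, `k = 0` is equivariant by definition.  On a
BALL the statement is FALSE (`φ`-linear solutions: J♭ below).  Evidence: exact jet counts `h_k = 0` (`k = 2..8`), `h_1 = 1` at 9 generic
bases × 3 points and at the Landau base with a non-vertex centre, stable to order 14; no Jordan chain at `k = ±1`; `h = 0` also at the
non-integer / complex mode parameters `1/2, 3/2, 7/2, i, 2i, 1+i, (1+i)/2, 2+3i` (`AzimuthalCartanResults.md`).  Why it might fail: the
degeneracy locus of the symbol could be larger than the homogeneous jets (untested special bases: with potential swirl `κ ≠ 0`, or with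
`curl V = 0` at the section centre), and "formal at sampled bases to order 14" is not "at all orders for all bases".  Booking words (P5):
no construction BY ANALYTIC DEFORMATION THROUGH THE AXISYMMETRIC NO-SWIRL FAMILY off a scaling vertex — formally, linearised, at sampled
bases.  Sources: Bryant–Chern–Gardner–Goldschmidt–Griffiths, *Exterior Differential Systems* (1991) ch. IX–X; Šverák arXiv:math/0604550;
Li–Li–Yan arXiv:1609.08197, arXiv:1704.08730; Shtern–Hussain doi:10.1017/s0022112093002873 (vertex sector, see V♯). -/
def InfinitesimalRigidityOffCentre : Prop :=
  ∀ (V : E3 → E3) (p : E3 → ℝ) (a x₀ : E3) (c : ℝ × ℝ) (ε : ℝ), 0 < ε → ε < c.1 →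
    IsAxisymmetricBaseOn (solidTorus x₀ a c ε) x₀ (crossCLM a) V p →
    ¬ IsMinusOneHomogeneousOn (solidTorus x₀ a c ε) x₀ V →
    InfinitesimallyRigidOn (solidTorus x₀ a c ε) x₀ (crossCLM a) V

/-- (I♭_ball — the v1.0/v1.1 typing, on BALLS; v1.2: **FALSE**, refuted by J♭ via `ballRigidity_refuted`; kept as the settled negative
edge.)  On a ball off the axis the azimuth is a genuine coordinate and `φ · e_φ/ρ + u₀(ρ,z)` is an analytic unthreaded solution of the
linearised system which is not a tilt plus an equivariant field (critic V26 P1, made sharp by the engine's Jordan test). -/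
def InfinitesimalRigidityOffCentreBall : Prop :=
  ∀ (V : E3 → E3) (p : E3 → ℝ) (a x₀ x₁ : E3) (ρ : ℝ), 0 < ρ →
    IsAxisymmetricBaseOn (ball x₁ ρ) x₀ (crossCLM a) V p → ¬ IsMinusOneHomogeneousOn (ball x₁ ρ) x₀ V →
    InfinitesimallyRigidOn (ball x₁ ρ) x₀ (crossCLM a) V

/-- (J♭, v1.3 — PROVABLE, S–M, fully explicit; the typed form of critic V26 P1) **The `φ`-linear mode on a ball.**  At the
Poiseuille base with centre `x₀ = 0` on its axis, on `ball xTest 1` (where `x > 0`, so the azimuth is an analytic coordinate), the explicit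
field `jordanMode` with `δp = 0` is an analytic solution of the linearised steady NS system, unthreaded about `0` (its curl is
`−g′(ρ) e_φ`, `g = (ρ²/2)(log ρ − 1)`; the gradient part is curl-free), and it is NOT a tilt plus a `J₃`-equivariant field: the Lie derivative
along the rotation kills equivariant fields, maps tilts to tilts (pure `k = 1` fields), but sends `jordanMode` to the non-zero AXISYMMETRIC
field `e_φ/ρ`.  Engine certificate `jordan_check.py` (residuals ≤ 5e-16).  (v1.2 stated this at the Landau base via Cauchy–Kovalevskaya; the
Poiseuille base makes the correction `u₀` elementary: `u₀ = −(log ρ/ρ) e_ρ + g(ρ) e₃`.) -/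
def PoiseuilleJordanMode : Prop :=
  AnalyticOnNhd ℝ jordanMode (ball xTest 1) ∧ LinearisedSteadyNSOn (ball xTest 1) poiseuille jordanMode 0 ∧
    IsUnthreadedOn (ball xTest 1) 0 jordanMode ∧ ¬ ∃ Ω : E3, IsEquivariantOn (ball xTest 1) 0 J3 (jordanMode - tilt poiseuille 0 Ω)

/-- (L′, S) the Poiseuille base facts on `ball xTest 1` about `(0, J₃)`: admissible axisymmetric base (polynomial field; `curl V (xTest) =
(0, 6, 0)`), and not (−1)-homogeneous about `0` (`DV(x)x = 2V(x) ≠ −V(x)` at `xTest`). -/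
def PoiseuilleBaseFacts : Prop :=
  IsAxisymmetricBaseOn (ball xTest 1) 0 J3 poiseuille poiseuillePressure ∧ ¬ IsMinusOneHomogeneousOn (ball xTest 1) 0 poiseuille

/-- (J♭-Landau, the v1.2 statement kept BY NAME for consumers typing against v1.2 — PROVABLE but L+ in Lean: needs Cauchy–Kovalevskaya for
the forced poloidal corrector `u₀`; the cheap route is the Poiseuille J♭ above) At the Landau base `landau2` with the off-vertex centre `e₃` on
its axis, on some ball about `xTest`, there is an analytic unthreaded solution of the linearised system which is not a tilt plus a
`J₃`-equivariant field (`δv = φ∇φ + u₀(ρ,z)`). -/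
def LandauBallJordanMode : Prop :=
  ∃ ρ : ℝ, 0 < ρ ∧ ρ ≤ 1 ∧ ∃ (δv : E3 → E3) (δp : E3 → ℝ),
    AnalyticOnNhd ℝ δv (ball xTest ρ) ∧ AnalyticOnNhd ℝ δp (ball xTest ρ) ∧
    LinearisedSteadyNSOn (ball xTest ρ) landau2 δv δp ∧ IsUnthreadedOn (ball xTest ρ) e3 δv ∧
    ¬ ∃ Ω : E3, IsEquivariantOn (ball xTest ρ) e3 J3 (δv - tilt landau2 e3 Ω)

/-- (V♯, computed negative fact — typed as a statement to be PROVED by exhibiting one of the six solutions; v1.2: on the solid torus)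
**Landau vertex flexibility.**  At the base `landau2` (= `landauAxisField e₃ 2`) with centre the VERTEX `x₀ = 0`, on `landauTorus` (the
rotation-invariant solid torus through `xTest`, away from the axis and the vertex), there is an
analytic solution of the linearised steady NS system, unthreaded about `0`, which is NOT a tilt plus a `J₃`-equivariant field.  Evidence:
`h_k = 6` for `k = 1..5` (stable, orders 10 and 12, two points); `indicial.py`: the six are homogeneous, four of degree −1 and two of
degree −2 in `δv` (characteristic polynomial `μ⁴(μ+1)²` of the scaling generator, diagonalisable), so e.g. a `k = 2` degree-(−1) solution
is an explicit rational-trigonometric field times `cos 2φ` / `sin 2φ` (to be extracted from the engine's nullspace), defined on the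
whole cone off the axis, hence on the torus.  Why it might fail: only if the formal solutions failed to converge — excluded here since
they are homogeneous functions determined by an ODE in the polar angle with analytic coefficients away from the axis.  NEAREST PRINT
(critic V26 P3): Shtern–Hussain, JFM 256 (1993) 535–560, doi:10.1017/s0022112093002873; JFM 366 (1998), doi:10.1017/s002211209800891x —
per-azimuthal-wavenumber steady symmetry breaking of conically similar flows, an ODE eigenproblem in the polar angle WITH regularity on the
whole sphere (bifurcation at critical Reynolds numbers); V♯ is their setting without boundary conditions and with the unthreaded
constraint added (6 per mode: 4 of degree −1 ⊇ the 2-per-mode linearised Liouville class, 2 of degree −2). -/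
def LandauVertexFlexibility : Prop :=
  ∃ (δv : E3 → E3) (δp : E3 → ℝ), AnalyticOnNhd ℝ δv landauTorus ∧ AnalyticOnNhd ℝ δp landauTorus ∧
    LinearisedSteadyNSOn landauTorus landau2 δv δp ∧ IsUnthreadedOn landauTorus 0 δv ∧
    ¬ ∃ Ω : E3, IsEquivariantOn landauTorus 0 J3 (δv - tilt landau2 0 Ω)

/-- (L, S-sized facts about the explicit Landau flow on the test torus, routine but not proved in this sketch) `landau2, landauPressure2`
(= `landauAxisField e₃ 2`, `landauAxisPressure e₃ 2`; smoothness off the axis half-line is the tree's `contDiffOn_landauAxisField`) form an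
admissible axisymmetric base on `landauTorus` about `(0, J₃)`: analytic, steady NS, `J₃`-equivariant, no swirl, `curl ≢ 0`.
[Landau 1944; Šverák arXiv:math/0604550, §2; checked symbolically in the engine: base residuals vanish identically] -/
def LandauBaseFacts : Prop :=
  IsAxisymmetricBaseOn landauTorus 0 J3 landau2 landauPressure2

/-- (C♭, the BALL statement — v1.3: **FALSE**, refuted by the explicit sectorial cross flows K♭ via `crossFlows_refute_ballRigidity`;
kept as the settled negative edge) **Steady local rigidity off the centre (ball version).**  An analytic steady NS flow on a ball, unthreaded
about `x₀`, with `curl ≢ 0`, not (−1)-homogeneous about `x₀`, is infinitesimally axisymmetric about an axis through `x₀` with constant swirl.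
FALSE on balls: `u_γ = ∇[γ(φ² − log²ρ)] + G_γ(ρ) e₃` (`crossFlow`).  The supported nonlinear statement is C♯ (full shells: rotation-invariant
about every axis through `x₀`, where neither `φ` nor a cut exists). -/
def SteadyLocalRigidityOffCentre : Prop :=
  ∀ (V : E3 → E3) (p : E3 → ℝ) (x₀ x₁ : E3) (ρ : ℝ), 0 < ρ →
    AnalyticOnNhd ℝ V (ball x₁ ρ) → AnalyticOnNhd ℝ p (ball x₁ ρ) → IsSteadyNSOn (ball x₁ ρ) V p →
    IsUnthreadedOn (ball x₁ ρ) x₀ V → (∃ x ∈ ball x₁ ρ, curl V x ≠ 0) → ¬ IsMinusOneHomogeneousOn (ball x₁ ρ) x₀ V →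
    ∃ A : E3 →L[ℝ] E3, IsSkewAxis A ∧ IsEquivariantOn (ball x₁ ρ) x₀ A V ∧ HasConstantSwirlOn (ball x₁ ρ) x₀ A V

/-- (C♭₀, the UNRESTRICTED version — conjecturally FALSE, see K♯) the same without the non-homogeneity clause. -/
def SteadyLocalRigidityOffCentreUnrestricted : Prop :=
  ∀ (V : E3 → E3) (p : E3 → ℝ) (x₀ x₁ : E3) (ρ : ℝ), 0 < ρ →
    AnalyticOnNhd ℝ V (ball x₁ ρ) → AnalyticOnNhd ℝ p (ball x₁ ρ) → IsSteadyNSOn (ball x₁ ρ) V p →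
    IsUnthreadedOn (ball x₁ ρ) x₀ V → (∃ x ∈ ball x₁ ρ, curl V x ≠ 0) →
    ∃ A : E3 →L[ℝ] E3, IsSkewAxis A ∧ IsEquivariantOn (ball x₁ ρ) x₀ A V ∧ HasConstantSwirlOn (ball x₁ ρ) x₀ A V

/-- (K♯ — ESSENTIALLY IN PRINT, to be typed as a Literature fact; the count re-detects it) **Poloidal conical flows.**  There is an
analytic steady NS flow on some ball, (−1)-homogeneous about a point `x₀` outside it and unthreaded about `x₀`, with `curl ≢ 0`, which is NOT
infinitesimally axisymmetric with constant swirl about any axis through `x₀` on that ball.  WITNESSES IN PRINT: Šverák's conformal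
correspondence (arXiv:math/0604550 §3–4; tree: `SverakLandauConformal`, `exists_conformal_potential`) builds a (−1)-homogeneous steady NS
flow with tangential part `∇_{S²}φ` — hence unthreaded about the vertex — from every solution of the Liouville equation
`−Δ_{S²}φ + 2 = 2e^{φ}`, i.e. from every locally univalent meromorphic `f` via `φ = log (|f′|²(1+|z|²)²/(1+|f|²)²)`; `f = az` gives Landau,
and NON-axisymmetric local examples come from e.g. `f = a e^{bz}` (survey arXiv:2509.07243 §2.1.3, p. 7: "non-axisymmetric solutions can
be constructed by choosing suitable forms of f").  The jet count sees them: at the Landau base with centre = vertex there are, per azimuthal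
mode, 4 formal solutions homogeneous of degree −1 (≥ 2 of them = the linearised Liouville class; whether the other 2 — non-constant
Bernoulli head `K` on spherical caps — integrate to exact flows is OPEN) and 2 of degree −2.  NUMERICALLY CERTIFIED (v1.1, `conformal_check.py`, order-3
automatic differentiation): for `f = e^{z}` and `f = e^{0.6z}` the flow `u = ∇Φ + (2e^{Φ} − 2)x/|x|²`, `p = (2e^{Φ} − 2)/|x|² − ½|∇Φ|²`
(`Φ(x) = φ(x/|x|)`; normalisation checked on Landau) has steady-NS residual ≤ 4e-14 against O(1) terms, `div u`, `x·curl u` ≤ 5e-15,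
`|curl u|` up to 2.75, and rotational-equivariance defect `min_{|a|=1} Σ|Du(a×x) − a×u|² = 2.01` resp. `0.81` (Landau: 1e-30): NO axis.
What typing must still do: the same four facts as Lean statements about the explicit field on a ball inside its cone of smoothness.
Sources: Šverák arXiv:math/0604550; Li–Li–Yan arXiv:1609.08197, 1704.08730, 1901.08218; survey arXiv:2509.07243 §2.1.3. -/
def PoloidalConicalFlows : Prop :=
  ∃ (V : E3 → E3) (p : E3 → ℝ) (x₀ x₁ : E3) (ρ : ℝ), 0 < ρ ∧
    AnalyticOnNhd ℝ V (ball x₁ ρ) ∧ AnalyticOnNhd ℝ p (ball x₁ ρ) ∧ IsSteadyNSOn (ball x₁ ρ) V p ∧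
    IsUnthreadedOn (ball x₁ ρ) x₀ V ∧ (∃ x ∈ ball x₁ ρ, curl V x ≠ 0) ∧ IsMinusOneHomogeneousOn (ball x₁ ρ) x₀ V ∧
    ¬ ∃ A : E3 →L[ℝ] E3, IsSkewAxis A ∧ IsEquivariantOn (ball x₁ ρ) x₀ A V ∧ HasConstantSwirlOn (ball x₁ ρ) x₀ A V

/-- (K♭, v1.3 — PROVABLE, M: explicit calculus + the fundamental theorem of calculus for `G_γ`; analyticity of the primitive of an analytic
function is the only non-routine line) **Sectorial cross flows.**  For every `γ ≠ 0`, on `ball xTest 1` with centre `x₀ = 0`: `crossFlow γ`,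
`crossFlowPressure γ` form an analytic steady NS flow, unthreaded about `0`, with `curl ≢ 0`, not (−1)-homogeneous about `0`, and NOT
infinitesimally axisymmetric with constant swirl about ANY axis through `0`.  Paper proof: `u = ∇Χ + G(ρ)e₃` with `Χ = γ(φ² − log²ρ)` planar
harmonic ⇒ `div u = 0`; `(u·∇)u = ∇(|u|²/2 − G²/2) + (∇Χ·∇G) e₃`, `Δu = (Δ₂G) e₃`, and `Δ₂G − ∇Χ·∇G = G″ + (1 + 2γ log ρ)G′/ρ = 0` for
`G′ = ρ⁻¹e^{−γ log²ρ}` ⇒ NS with `p = −|u|²/2 + G²/2`; `curl u = −G′(ρ) e_φ ⊥ x`; `L_{e₃} u = 2γ e_φ/ρ ≠ 0`, and equivariance about another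
axis through `0` would make the azimuthal field `curl u` invariant under all of `SO(3)`, hence `0`.  CLASS in print (potential cross flow +
axial advection–diffusion profile): Weinbaum–O'Brien 1967 doi:10.1063/1.1762303; Wang 1991 doi:10.1146/annurev.fl.23.010191.001111.  Engine
certificate: `crossflow_check.py` (`γ = 0.5, 2`). -/
def SectorialCrossFlows : Prop :=
  ∀ γ : ℝ, γ ≠ 0 →
    AnalyticOnNhd ℝ (crossFlow γ) (ball xTest 1) ∧ AnalyticOnNhd ℝ (crossFlowPressure γ) (ball xTest 1) ∧
    IsSteadyNSOn (ball xTest 1) (crossFlow γ) (crossFlowPressure γ) ∧ IsUnthreadedOn (ball xTest 1) 0 (crossFlow γ) ∧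
    (∃ x ∈ ball xTest 1, curl (crossFlow γ) x ≠ 0) ∧ ¬ IsMinusOneHomogeneousOn (ball xTest 1) 0 (crossFlow γ) ∧
    ¬ ∃ A : E3 →L[ℝ] E3, IsSkewAxis A ∧ IsEquivariantOn (ball xTest 1) 0 A (crossFlow γ) ∧ HasConstantSwirlOn (ball xTest 1) 0 A (crossFlow γ)

/-- (K♭₁, v1.3c — the `γ = 1` instance of K♭, stated separately so a prover carries no parameter (critic V26-R2); this is all the glue
consumes.) -/
def SectorialCrossFlowOne : Prop :=
  AnalyticOnNhd ℝ (crossFlow 1) (ball xTest 1) ∧ AnalyticOnNhd ℝ (crossFlowPressure 1) (ball xTest 1) ∧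
    IsSteadyNSOn (ball xTest 1) (crossFlow 1) (crossFlowPressure 1) ∧ IsUnthreadedOn (ball xTest 1) 0 (crossFlow 1) ∧
    (∃ x ∈ ball xTest 1, curl (crossFlow 1) x ≠ 0) ∧ ¬ IsMinusOneHomogeneousOn (ball xTest 1) 0 (crossFlow 1) ∧
    ¬ ∃ A : E3 →L[ℝ] E3, IsSkewAxis A ∧ IsEquivariantOn (ball xTest 1) 0 A (crossFlow 1) ∧ HasConstantSwirlOn (ball xTest 1) 0 A (crossFlow 1)

/-- (C♯, conjecture C — semi-local: local in the radius, global in the angles) **Steady shell rigidity.**  An analytic steady NS flow on a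
full spherical shell about `x₀`, unthreaded about `x₀` there, with `curl ≢ 0`, is infinitesimally axisymmetric about an axis through `x₀`
with constant swirl on the shell (the constant is then `0`: the axis meets the shell).  No homogeneity clause: a (−1)-homogeneous flow on
a FULL shell extends to `ℝ³ ∖ {x₀}` and is Landau by Šverák's theorem.  Why it might fail: as C♭ (exotic component), now also requiring
the local symmetry axes of different patches to agree (they do for analytic flows on a connected shell: identity theorem).  Sources: as
I♭; Šverák arXiv:math/0604550 Thm 1. -/
def SteadyShellRigidity : Prop :=
  ∀ (V : E3 → E3) (p : E3 → ℝ) (x₀ : E3) (r₁ r₂ : ℝ), 0 < r₁ → r₁ < r₂ →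
    AnalyticOnNhd ℝ V (shell x₀ r₁ r₂) → AnalyticOnNhd ℝ p (shell x₀ r₁ r₂) → IsSteadyNSOn (shell x₀ r₁ r₂) V p →
    IsUnthreadedOn (shell x₀ r₁ r₂) x₀ V → (∃ x ∈ shell x₀ r₁ r₂, curl V x ≠ 0) →
    ∃ A : E3 →L[ℝ] E3, IsSkewAxis A ∧ IsEquivariantOn (shell x₀ r₁ r₂) x₀ A V ∧ HasConstantSwirlOn (shell x₀ r₁ r₂) x₀ A V

/-- The steady stratum of 1222 in classical form — VERBATIM twin of `CentreJetSketch.SteadyUnthreadedLiouville` (crux workfile, l.356;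
g5): a bounded classical steady NS flow on `ℝ³` unthreaded about a point is constant.  OPEN. -/
def SteadyUnthreadedLiouville' : Prop :=
  ∀ (V : E3 → E3) (p : E3 → ℝ) (x₀ : E3), IsSteadyNSOn univ V p → (∃ B : ℝ, ∀ x, ‖V x‖ ≤ B) →
    IsUnthreadedAbout x₀ V → ∃ b : E3, ∀ x, V x = b

/-- (R♯, reduction — OPEN, M-sized, paper-sketched) **Shell rigidity decides the steady stratum.**  Sketch: a bounded entire steady flow is
analytic (tree: `steadyNS_analytic`-type facts used by g5's engine); if `curl V ≡ 0` use `CentreJet.irrotationalSteadyLiouville`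
(kernel, p677698); else pick a shell about `x₀` containing a point with `curl ≠ 0`, get `A` from C♯, extend `A`-equivariance and the
swirl identity to `ℝ³` by the identity theorem (`SilentShells.isAxisymmetric_of_locallyAxisymmetric` pattern), read `κ = 0` on the axis,
convert the infinitesimal symmetry to a frame `g` with `rotZ`-equivariance (the one genuinely new formal step: integrate the rotation
flow), and finish with g5's engine `CentreJet.eq_const_of_local_symmetry` (KNSS 2009 Thm 5.2 [Literature fact] + `steadyClassicalIsMild`
+ `steadyNSGradientBounds`). -/
def ShellReduction : Prop := SteadyShellRigidity → SteadyUnthreadedLiouville'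

end Summit.NavierStokesRegularity.NavierStokesRegularity.Theorems.PoloidalLiouville.AzimuthalCartan

end
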